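import Summits.Ventures.PercRepro.ProfilePointedCaptured
import Summits.Ventures.PercRepro.ProfileGapMonoThresholdTopNullityPred

/-!
# PercRepro — THE MIRROR IDENTITY OF THE CAPTURED FAMILY: `out_k + κ_{n−1−k} = in_{k+1} + κ_k`, AND THE SHARP FORM
OF THE CROSS PAIRING (p5, gen 34; `proofs/P5-GM1.md` §46(b), (h))

For a point `p` of a finite matroid `M` on `n` points, `out_k = #{X ∈ BI_k : p ∉ X}`, `in_k = #{X ∈ BI_k : p ∈ X}`
(p10's `outCount` / `inCount`) and `κ_k = #{X ∈ BI_k : p ∉ X, p ∈ cl X}` (p10's `capCount`).  The map `X ↦ X ∪ p`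
sends the `p`-avoiding bi-independent `k`-sets with `p ∉ cl X` bijectively onto the `p`-containing bi-independent
`(k+1)`-sets `Y` with `p ∉ cl(E ∖ Y)` (`inCount_eq_extCount_add_capCount`); the remaining `Y` — those with
`p ∈ cl(E ∖ Y)` — are, through `Y ↦ E ∖ Y`, exactly the captured sets at the level `n − k − 1`.  Hence THE MIRROR
IDENTITY `out_k + κ_{n−1−k} = in_{k+1} + κ_k` (`outCount_add_capCount_mirror`): the cross pairing `out_k ≤ in_{k+1}`
(`BiIndepPointed`, Theorem A's per-point form) is EQUIVALENT to the mirror dominance `κ_k ≤ κ_{n−1−k}` of the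
captured family (`CapMirror`; `biIndepPointed_iff_capMirror`), and the SHARP form `(n − 1 − k)·κ_k ≤ k·κ_{n−1−k}`
(`CapMirrorSharp`, §46(h); 0 violations on every matroid with `≤ 9` elements) implies it.  All conjecture defs are
NOT asserted; the identities are unconditional.

* `inCount_eq_extCount_add_capCount`, **`outCount_add_capCount_mirror`**, `capCount_zero`;
* `CapMirror` (conjecture def), **`biIndepPointed_iff_capMirror`**;
* `CapMirrorSharp` (conjecture def), `capMirror_of_capMirrorSharp`, `biIndepUnimodal_of_capMirrorSharp`,
  `thresholdIneq_top_of_nullity_le_pred_of_capMirrorSharp`.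
-/

open scoped Matroid

namespace PercRepro.Cogirth

open Finset ThmH Skew Shadow Profile

variable {α : Type} [DecidableEq α] {M : Matroid α} [M.Finite]

section MirrorIdentity

/-- A bi-independent set's complement is bi-independent (the bijection behind `card_biIndepSets_symm`). -/
theorem sdiff_mem_biIndepSets {k : ℕ} {Y : Finset α} (hY : Y ∈ biIndepSets M k) :
    gr M \ Y ∈ biIndepSets M ((gr M).card - k) := by
  rw [mem_biIndepSets] at hY ⊢
  obtain ⟨hYg, hYk, hYr, hYc⟩ := hY
  refine ⟨sdiff_subset, ?_, hYc, ?_⟩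
  · rw [card_sdiff_of_subset hYg, hYk]
  · rw [Finset.sdiff_sdiff_eq_self hYg, hYr]

/-- `in_{k+1} = c_k + κ_{n−k−1}`: a `p`-containing bi-independent `(k+1)`-set `Y` either has `p ∉ cl(E ∖ Y)` — then
`Y ∖ p` is a `p`-avoiding bi-independent `k`-set extending by `p` — or `p ∈ cl(E ∖ Y)` — then `E ∖ Y` is a captured
set at the level `n − k − 1`. -/
theorem inCount_eq_extCount_add_capCount (k : ℕ) {p : α} (hp : p ∈ gr M) (hk : k + 1 ≤ (gr M).card) :
    inCount M (k + 1) p = extCount M k p + capCount M ((gr M).card - (k + 1)) p := by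
  unfold inCount extCount capCount
  have hsplit := card_filter_add_card_filter_not (s := (biIndepSets M (k + 1)).filter (fun Y => p ∈ Y))
    (fun Y => p ∉ clF M (gr M \ Y))
  rw [filter_filter, filter_filter] at hsplit
  rw [← hsplit]
  congr 1
  · -- `X ↦ insert p X`
    symm
    apply card_bij (fun X _ => insert p X)
    · intro X hX
      rw [mem_filter] at hX ⊢
      obtain ⟨hXk, hpX, hins⟩ := hX
      refine ⟨hins, mem_insert_self _ _, ?_⟩
      intro hcl
      rw [mem_biIndepSets] at hXk
      obtain ⟨hXg, -, -, hXc⟩ := hXk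
      have hsub : gr M \ insert p X ⊆ gr M := sdiff_subset
      have hins' : insert p (gr M \ insert p X) = gr M \ X := by
        ext y
        simp only [mem_insert, mem_sdiff, not_or]
        constructor
        · rintro (rfl | ⟨hy, hyp, hyX⟩)
          · exact ⟨hp, hpX⟩
          · exact ⟨hy, hyX⟩
        · rintro ⟨hy, hyX⟩
          by_cases hyp : y = p
          · exact Or.inl hyp
          · exact Or.inr ⟨hy, hyp, hyX⟩
      have h1 := rk_insert_eq hp hsub
      rw [if_pos hcl, hins'] at h1
      have h2 : rk M (gr M \ insert p X) ≤ (gr M \ insert p X).card := rk_le_card' _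
      have h3 : (gr M \ insert p X).card + 1 = (gr M \ X).card := by
        rw [← hins', card_insert_of_notMem (fun h => (mem_sdiff.1 h).2 (mem_insert_self p X))]
      omega
    · intro X₁ hX₁ X₂ hX₂ h
      rw [mem_filter] at hX₁ hX₂
      have e1 := congrArg (fun Y => Y.erase p) h
      simp only [erase_insert hX₁.2.1, erase_insert hX₂.2.1] at e1
      exact e1
    · intro Y hY
      rw [mem_filter] at hY
      obtain ⟨hYk, hpY, hcl⟩ := hY
      refine ⟨Y.erase p, ?_, insert_erase hpY⟩
      rw [mem_filter]
      have hYk' := hYk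
      rw [mem_biIndepSets] at hYk'
      obtain ⟨hYg, hYc, hYr, hYco⟩ := hYk'
      have hsub : gr M \ Y ⊆ gr M := sdiff_subset
      have hins' : insert p (gr M \ Y) = gr M \ Y.erase p := by
        ext y
        simp only [mem_insert, mem_sdiff, mem_erase, not_and]
        constructor
        · rintro (rfl | ⟨hy, hyY⟩)
          · exact ⟨hp, fun h => absurd rfl h⟩
          · exact ⟨hy, fun _ hyY' => absurd hyY' hyY⟩
        · rintro ⟨hy, hyY⟩
          by_cases hyp : y = p
          · exact Or.inl hyp
          · exact Or.inr ⟨hy, fun hyY' => hyY hyp hyY'⟩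
      have h1 := rk_insert_eq hp hsub
      rw [if_neg hcl, hins'] at h1
      refine ⟨?_, notMem_erase p Y, ?_⟩
      · rw [mem_biIndepSets]
        refine ⟨(erase_subset p Y).trans hYg, ?_, ?_, ?_⟩
        · rw [card_erase_of_mem hpY, hYc]
          omega
        · exact rk_eq_card_of_subset_of_rk_eq_card (erase_subset p Y) hYr
        · rw [h1, hYco, ← hins', card_insert_of_notMem (fun h => (mem_sdiff.1 h).2 hpY)]
      · rw [insert_erase hpY]
        exact hYk
  · -- `Y ↦ gr M \ Y`
    apply card_bij (fun Y _ => gr M \ Y)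
    · intro Y hY
      rw [mem_filter] at hY ⊢
      obtain ⟨hYk, hpY, hcl⟩ := hY
      refine ⟨sdiff_mem_biIndepSets hYk, fun h => (mem_sdiff.1 h).2 hpY, not_not.1 hcl⟩
    · intro Y₁ hY₁ Y₂ hY₂ h
      rw [mem_filter] at hY₁ hY₂
      have g1 : Y₁ ⊆ gr M := (mem_biIndepSets.1 hY₁.1).1
      have g2 : Y₂ ⊆ gr M := (mem_biIndepSets.1 hY₂.1).1
      have e := congrArg (fun Z => gr M \ Z) h
      simp only [Finset.sdiff_sdiff_eq_self g1, Finset.sdiff_sdiff_eq_self g2] at e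
      exact e
    · intro Z hZ
      rw [mem_filter] at hZ
      obtain ⟨hZk, hpZ, hcl⟩ := hZ
      have hZg : Z ⊆ gr M := (mem_biIndepSets.1 hZk).1
      refine ⟨gr M \ Z, ?_, Finset.sdiff_sdiff_eq_self hZg⟩
      rw [mem_filter]
      have hk' : (gr M).card - ((gr M).card - (k + 1)) = k + 1 := by omega
      refine ⟨?_, ?_, ?_⟩
      · have := sdiff_mem_biIndepSets hZk
        rw [hk'] at this
        exact this
      · simp only [mem_sdiff, hp, hpZ, not_false_eq_true, and_self]
      · rw [Finset.sdiff_sdiff_eq_self hZg]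
        exact fun h => h hcl

/-- **THE MIRROR IDENTITY** `out_k + κ_{n−1−k} = in_{k+1} + κ_k` (from `out_k = κ_k + c_k` and
`in_{k+1} = c_k + κ_{n−k−1}`). -/
theorem outCount_add_capCount_mirror (k : ℕ) {p : α} (hp : p ∈ gr M) (hk : k + 1 ≤ (gr M).card) :
    outCount M k p + capCount M ((gr M).card - (k + 1)) p = inCount M (k + 1) p + capCount M k p := by
  rw [inCount_eq_extCount_add_capCount k hp hk, ← capCount_add_extCount k hp]
  ring

/-- No bi-independent `0`-set captures a point: `κ_0 = 0` (if `∅` is bi-independent the ground set is independent,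
so `cl ∅` contains no point of it). -/
theorem capCount_zero {p : α} (hp : p ∈ gr M) : capCount M 0 p = 0 := by
  unfold capCount
  rw [card_eq_zero, filter_eq_empty_iff]
  intro X hX ⟨hpX, hcl⟩
  rw [mem_biIndepSets] at hX
  obtain ⟨hXg, hX0, hXr, hXc⟩ := hX
  rw [card_eq_zero] at hX0
  subst hX0
  have h := rk_insert_eq hp (empty_subset (gr M))
  rw [if_pos hcl] at h
  have hrk0 : rk M (∅ : Finset α) = 0 := by
    rw [hXr, card_empty]
  have hsub : ({p} : Finset α) ⊆ gr M \ ∅ := by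
    intro y hy
    rw [mem_singleton] at hy
    subst hy
    simp only [mem_sdiff, hp, notMem_empty, not_false_eq_true, and_self]
  have h1 := rk_eq_card_of_subset_of_rk_eq_card hsub hXc
  rw [card_singleton, insert_empty] at *
  rw [h1] at h
  omega

end MirrorIdentity

section Mirror

/-- **THE MIRROR DOMINANCE OF THE CAPTURED FAMILY** (a `Prop`; a CONJECTURE, NOT asserted): `κ_k ≤ κ_{n−1−k}` for
`2k + 2 ≤ n` — equivalent to the per-point form `out_k ≤ in_{k+1}` of Theorem A (`biIndepPointed_iff_capMirror`). -/
def CapMirror (α : Type) [DecidableEq α] : Prop :=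
  ∀ (M : Matroid α) [M.Finite] (p : α) (k : ℕ), p ∈ gr M → 2 * k + 2 ≤ (gr M).card →
    capCount M k p ≤ capCount M ((gr M).card - (k + 1)) p

/-- The per-point form of Theorem A and the mirror dominance of the captured family are the same conjecture. -/
theorem biIndepPointed_iff_capMirror : BiIndepPointed α ↔ CapMirror α := by
  constructor
  · intro h M _ p k hp hk
    have h1 := h M p k hp hk
    have h2 := outCount_add_capCount_mirror (M := M) k hp (by omega)
    omega
  · intro h M _ p k hp hk
    have h1 := h M p k hp hk
    have h2 := outCount_add_capCount_mirror (M := M) k hp (by omega)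
    omega

/-- **THE SHARP FORM (MIRκ)** (a `Prop`; a CONJECTURE, NOT asserted): `(n − 1 − k)·κ_k ≤ k·κ_{n−1−k}` for `1 ≤ k`,
`2k + 2 ≤ n` — the captured density `κ_m / C(n−2, m−1)` dominated by its mirror around `(n−1)/2`; 0 violations on every
matroid with `≤ 9` elements (§46(h)). -/
def CapMirrorSharp (α : Type) [DecidableEq α] : Prop :=
  ∀ (M : Matroid α) [M.Finite] (p : α) (k : ℕ), p ∈ gr M → 1 ≤ k → 2 * k + 2 ≤ (gr M).card →
    ((gr M).card - (k + 1)) * capCount M k p ≤ k * capCount M ((gr M).card - (k + 1)) p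

/-- The sharp form implies the mirror dominance (`k ≤ n − 1 − k`; the level `0` is empty). -/
theorem capMirror_of_capMirrorSharp (h : CapMirrorSharp α) : CapMirror α := by
  intro M _ p k hp hk
  rcases Nat.eq_zero_or_pos k with hk0 | hk1
  · subst hk0
    rw [capCount_zero hp]
    exact Nat.zero_le _
  · have h1 := h M p k hp hk1 hk
    have h2 : k * capCount M k p ≤ ((gr M).card - (k + 1)) * capCount M k p :=
      Nat.mul_le_mul_right _ (by omega)
    have h3 : k * capCount M k p ≤ k * capCount M ((gr M).card - (k + 1)) p := h2.trans h1
    exact Nat.le_of_mul_le_mul_left h3 hk1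

/-- The sharp form implies the unimodal form of Theorem A. -/
theorem biIndepUnimodal_of_capMirrorSharp (h : CapMirrorSharp α) : BiIndepUnimodal α :=
  biIndepUnimodal_of_pointed (biIndepPointed_iff_capMirror.2 (capMirror_of_capMirrorSharp h))

/-- The co-rank-`q` top threshold at nullity `≤ q − 1`, modulo the sharp form (MIRκ). -/
theorem thresholdIneq_top_of_nullity_le_pred_of_capMirrorSharp (h : CapMirrorSharp α) {N : Matroid α} [N.Finite]
    {q : ℕ} (hq : 2 ≤ q) (hn : (gr N).card ≤ rk N (gr N) + (q - 1)) (hR : q ≤ rk N (gr N)) :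
    ThresholdIneq N q (rk N (gr N) - 1) :=
  thresholdIneq_top_of_nullity_le_pred_of_unimodal (biIndepUnimodal_of_capMirrorSharp h) hq hn hR

end Mirror

end PercRepro.Cogirth
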